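import Summits.CriticalPhenomena.PercolationContinuityZ3.Theorems.PercNearOneGluingNoHeavyLowerTailQ44VertexCoverConeU
import Summits.CriticalPhenomena.PercolationContinuityZ3.Theorems.PercNearOneGluingNoHeavyLowerTailQ44TTConeUniversal

/-!
# Universality of the terminal-edge cone: the instance for the row `U`

Support file for crux `stmt-CriticalPhenomena-4575`, seat `prim-bnk-1` gen 39; memo `run/shared/lean/prim/prim-l12/FROM-prim-bnk-1-gen39-TT-CONE-UNIVERSAL.md`.
Companion of `…Q44TTConeUniversal` (engine and the `W` instance): the 34 rays `raysU` of the landed vertex-cover certificate `…Q44VertexCoverConeU` are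
(positive multiples of) images of the kernel under TERMINAL-EDGE words (`raysU_words`, from 33 one-step identities `raysU_step` checked by
`native_decide` — computational — along the suffix-closed word table `wordsU`), hence **`inCone_tact_U`** (a gadget table that maps the kernel into the
cone maps the whole cone into itself) and **`tactList_botbot_nonneg_U`**: for every list of component tables `Gs` with `InCone raysU (tact G kU)` and every
vertex-cover word `wd`, `0 ≤ (tactList Gs (actWord wd kU))(⊥,⊥)` (nonnegative two-copy fibre defect of the row `U`).  No sorries; standard axioms +
`Lean.ofReduceBool`.
-/

namespace Summit.CriticalPhenomena.PercolationContinuityZ3.Theorems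

namespace VCCone

open Finset TwoCopyMono

/-- The kernel of the row `U` (as in `…Q44VertexCoverConeU`). [this work] -/
def kU : Ker := fun i j => kerU i j

/-- Scaling factors: `(gU k) • raysU k` is a word image of `kU`. [this work] -/
def gU (k : Fin 34) : ℕ := if k.1 = 11 then 2 else 1

/-- Head generator (terminal edge `0 Eab … 5 Ecy`) of the word of ray `k` (`k ≥ 1`). [this work] -/
def hdUTab : Array ℕ :=
  #[0, 0, 1, 2, 3, 4, 5, 0, 0, 0, 0, 0, 1, 1, 1, 1, 2, 2, 2, 3, 3, 4, 0, 0, 0, 0, 1, 1, 1, 1, 1, 2, 2, 2]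

/-- The ray whose word is the tail of the word of ray `k` (`k ≥ 1`). [this work] -/
def prevUTab : Array ℕ :=
  #[0, 0, 0, 0, 0, 0, 0, 2, 3, 4, 5, 6, 3, 4, 5, 6, 4, 5, 6, 5, 6, 6, 12, 14, 16, 19, 16, 17, 19, 20, 21, 19, 20, 21]

/-- Head generator of ray `k`. [this work] -/
def hdU (k : Fin 34) : Fin 17 := ⟨(hdUTab[k.1]!) % 17, Nat.mod_lt _ (by decide)⟩

/-- Tail ray of ray `k`. [this work] -/
def prevU (k : Fin 34) : Fin 34 := ⟨(prevUTab[k.1]!) % 34, Nat.mod_lt _ (by decide)⟩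

/-- The terminal-edge word of ray `k` (generator indices `0…5`). [this work] -/
def wordsUTab : Array (List ℕ) :=
  #[[], [0], [1], [2], [3], [4], [5], [0, 1], [0, 2], [0, 3], [0, 4], [0, 5], [1, 2], [1, 3], [1, 4], [1, 5], [2, 3], [2, 4], [2, 5], [3, 4], [3, 5], [4, 5], [0, 1, 2], [0, 1, 4], [0, 2, 3], [0, 3, 4], [1, 2, 3], [1, 2, 4], [1, 3, 4], [1, 3, 5], [1, 4, 5], [2, 3, 4], [2, 3, 5], [2, 4, 5]]

/-- The word of ray `k`. [this work] -/
def wordsU (k : Fin 34) : List (Fin 17) :=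
  (wordsUTab[k.1]!).map fun m => ⟨m % 17, Nat.mod_lt _ (by decide)⟩

/-- All scaling factors are positive. [this work] -/
theorem gU_pos : ∀ k : Fin 34, 0 < gU k := by decide

/-- The tail ray has a smaller index. [this work] -/
theorem prevU_lt : ∀ k : Fin 34, k ≠ 0 → prevU k < k := by decide

/-- The word table is suffix closed along `prevU`/`hdU`. [this work] -/
theorem wordsU_cons : ∀ k : Fin 34, k ≠ 0 → wordsU k = hdU k :: wordsU (prevU k) := by decide

/-- The empty word belongs to ray 0. [this work] -/
theorem wordsU_zero : wordsU 0 = [] := by decide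

/-- The 33 one-step identities `(g k)·rays k = (g (prev k))·(E_(hd k)·rays (prev k))` (finite check). [this work] -/
theorem raysU_step : ∀ k : Fin 34, k ≠ 0 → ∀ x y : Fin 15,
    (gU k : ℤ) * raysU k x y = (gU (prevU k) : ℤ) * act (hdU k) (raysU (prevU k)) x y := by
  native_decide

/-- **The rays of the `U` certificate are terminal-edge word images of the kernel** (up to the factors `gU`). [this work] -/
theorem raysU_words : ∀ k : Fin 34, ∀ x y : Fin 15, (gU k : ℤ) * raysU k x y = actWord (wordsU k) kU x y := by
  suffices h : ∀ m : ℕ, ∀ k : Fin 34, k.1 = m → ∀ x y : Fin 15,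
      (gU k : ℤ) * raysU k x y = actWord (wordsU k) kU x y from fun k => h k.1 k rfl
  intro m
  induction m using Nat.strong_induction_on with
  | _ m ih =>
    intro k hk x y
    by_cases h0 : k = 0
    · subst h0
      rw [wordsU_zero]
      show (gU 0 : ℤ) * raysU 0 x y = kU x y
      rw [raysU_zero x y]
      simp [gU, kU]
    · rw [raysU_step k h0 x y, wordsU_cons k h0]
      have hlt : (prevU k).1 < m := hk ▸ prevU_lt k h0
      have ihk : ∀ x y, (gU (prevU k) : ℤ) * raysU (prevU k) x y = actWord (wordsU (prevU k)) kU x y :=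
        ih _ hlt (prevU k) rfl
      have hfun : (fun i j => (gU (prevU k) : ℤ) * raysU (prevU k) i j) = actWord (wordsU (prevU k)) kU := by
        funext i j; exact ihk i j
      rw [← act_smul, hfun]
      rfl

/-- The kernel is in its cone. [this work] -/
theorem inCone_kU : InCone raysU kU := inCone_U

/-- **Universality for `U`.**  A table that maps `kU` into the cone maps the whole cone into itself. [this work] -/
theorem inCone_tact_U {G : Table} (hG : InCone raysU (tact G kU)) {M : Ker} (hM : InCone raysU M) :
    InCone raysU (tact G M) :=
  inCone_tact_of_base raysU invariant_U wordsU gU gU_pos raysU_words hG hM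

/-- **Row `U` (fibre form) on every graph built from certified components**: for every list of gadget tables `Gs` with
`InCone raysU (tact G kU)` and every vertex-cover word `wd`, `0 ≤ (tactList Gs (actWord wd kU))(⊥,⊥)`. [this work] -/
theorem tactList_botbot_nonneg_U (Gs : List Table) (hGs : ∀ G ∈ Gs, InCone raysU (tact G kU))
    (wd : List (Fin 17)) : 0 ≤ tactList Gs (actWord wd kU) 0 0 :=
  tactList_botbot_nonneg_of_base raysU invariant_U raysU_botbot inCone_kU wordsU gU gU_pos raysU_words Gs hGs wd

end VCCone

end Summit.CriticalPhenomena.PercolationContinuityZ3.Theorems
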